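import Mathlib.NumberTheory.Padics.Complex
import Mathlib.Analysis.SpecialFunctions.Pow.Real
import HarnessLib

/-!
# Auxiliary `p`-adic facts for the kernel MODEL of Joshi's period-ring signature (branch E vacuity check, O1):
# rational norm exponents in `Q̄_p = PadicAlgCl p`, elements of prescribed norm, and powers of the norm as absolute values

Support file of the abc-iut cell, branch E (rung LADDER-ABC:A2.E; seat abc-iut-E-t3; E-plan-2 ruling 2026-08-26T07:28:52Z «O1: GO —
E-t3 builds the vacuity model of its carriers over Mathlib `PadicAlgCl p`»). Pure Mathlib number theory / analysis, no Joshi or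
[IUTchIII] content: it supplies the three facts the model `Joshi/TestThetaValuesLocusModel.lean` needs about the algebraic closure
`Q̄_p` of `ℚ_p` with its spectral norm (`Mathlib.NumberTheory.Padics.Complex`):
(R) every nonzero `x ∈ Q̄_p` has `‖x‖ = p^q` for some `q ∈ ℚ` (spectral norm = `‖a_0‖^{1/n}` for the minimal polynomial,
`spectralNorm_eq_norm_coeff_zero_rpow`, and `‖a_0‖ ∈ p^ℤ` in `ℚ_p`); (C) for every `q ∈ ℚ` there is `c ≠ 0` with `‖c‖ = p^q` (a root of
a power of `p`, `IsAlgClosed.exists_pow_nat_eq`); (P) for `e > 0` the power `‖·‖^e` is an absolute value on `Q̄_p` (ultrametricity).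
[folklore]
-/

noncomputable section

namespace Summit.ABC.IUTFork.Joshi.Model

open PadicAlgCl

variable (p : ℕ) [hp : Fact p.Prime]

/-- `1 < p` as a real number. [folklore] -/
private theorem one_lt_p : (1 : ℝ) < (p : ℝ) := by exact_mod_cast hp.out.one_lt

/-- `0 < p` as a real number. [folklore] -/
private theorem p_pos : (0 : ℝ) < (p : ℝ) := lt_trans one_pos (one_lt_p p)

/-- `‖p‖ = p⁻¹` in `Q̄_p`. [folklore] -/
private theorem norm_p : ‖(p : PadicAlgCl p)‖ = (p : ℝ)⁻¹ := by
  rw [← map_natCast (algebraMap ℚ_[p] (PadicAlgCl p)), ← PadicAlgCl.coe_eq]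
  show ‖((p : ℚ_[p]) : PadicAlgCl p)‖ = _
  rw [PadicAlgCl.norm_extends, Padic.norm_p]

/-- `‖p‖ = p^{-1}` as a real power. [folklore] -/
private theorem norm_p_eq_rpow : ‖(p : PadicAlgCl p)‖ = (p : ℝ) ^ (-1 : ℝ) := by
  rw [norm_p, Real.rpow_neg_one]

/-- `0 < ‖p‖ < 1` in `Q̄_p`. [folklore] -/
private theorem norm_p_pos_lt_one : 0 < ‖(p : PadicAlgCl p)‖ ∧ ‖(p : PadicAlgCl p)‖ < 1 := by
  rw [norm_p]
  exact ⟨inv_pos.2 (p_pos p), inv_lt_one_of_one_lt₀ (one_lt_p p)⟩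

/-- `(p : Q̄_p) ≠ 0`. [folklore] -/
private theorem p_ne_zero : (p : PadicAlgCl p) ≠ 0 := fun h => by
  have := (norm_p_pos_lt_one p).1
  rw [h, norm_zero] at this
  exact lt_irrefl _ this

/-! ## (C) Elements of every rational norm exponent -/

/-- **(C)** For every `q ∈ ℚ` there is a nonzero `c ∈ Q̄_p` with `‖c‖ = p^q`: a `q.den`-th root of `p^{−q.num}`. [folklore] -/
theorem exists_norm_eq_rpow (q : ℚ) : ∃ c : PadicAlgCl p, c ≠ 0 ∧ ‖c‖ = (p : ℝ) ^ (q : ℝ) := by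
  set d : PadicAlgCl p := (p : PadicAlgCl p) ^ (-q.num) with hd
  have hd0 : d ≠ 0 := zpow_ne_zero _ (p_ne_zero p)
  have hdn : ‖d‖ = (p : ℝ) ^ ((q.num : ℝ)) := by
    rw [hd, norm_zpow, norm_p, inv_zpow', Real.rpow_intCast]
    simp
  obtain ⟨c, hc⟩ := IsAlgClosed.exists_pow_nat_eq d q.pos
  have hc0 : c ≠ 0 := by
    rintro rfl
    rw [zero_pow q.pos.ne'] at hc
    exact hd0 hc.symm
  refine ⟨c, hc0, ?_⟩
  have hcn : ‖c‖ ^ q.den = (p : ℝ) ^ (q.num : ℝ) := by rw [← norm_pow, hc, hdn]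
  have hden : (q.den : ℝ) ≠ 0 := by exact_mod_cast q.pos.ne'
  calc ‖c‖ = (‖c‖ ^ q.den) ^ ((q.den : ℝ)⁻¹) := (Real.pow_rpow_inv_natCast (norm_nonneg c) q.pos.ne').symm
    _ = ((p : ℝ) ^ (q.num : ℝ)) ^ ((q.den : ℝ)⁻¹) := by rw [hcn]
    _ = (p : ℝ) ^ ((q.num : ℝ) * (q.den : ℝ)⁻¹) := by rw [← Real.rpow_mul (p_pos p).le]
    _ = (p : ℝ) ^ (q : ℝ) := by rw [← div_eq_mul_inv, ← Rat.cast_def]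

/-! ## (R) Norms in `Q̄_p` are rational powers of `p` -/

/-- Norms of nonzero elements of `ℚ_p` are integer powers of `p`. [folklore] -/
private theorem padic_norm_eq_rpow (x : ℚ_[p]) (hx : x ≠ 0) : ∃ n : ℤ, ‖x‖ = (p : ℝ) ^ (n : ℝ) :=
  ⟨-x.valuation, by rw [Padic.norm_eq_zpow_neg_valuation hx, Real.rpow_intCast]⟩

/-- **(R)** Every nonzero `x ∈ Q̄_p` has `‖x‖ = p^q` for some `q ∈ ℚ`: the spectral norm is `‖a_0‖^{1/n}` for the minimal polynomial
`Xⁿ + … + a_0` of `x` over `ℚ_p` (`spectralNorm_eq_norm_coeff_zero_rpow`), and `‖a_0‖ ∈ p^ℤ`. [folklore] -/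
theorem exists_norm_eq_rpow_rat (x : PadicAlgCl p) (hx : x ≠ 0) : ∃ q : ℚ, ‖x‖ = (p : ℝ) ^ (q : ℝ) := by
  have hint : IsIntegral ℚ_[p] x := (Algebra.IsAlgebraic.isAlgebraic (R := ℚ_[p]) x).isIntegral
  have h0 : (minpoly ℚ_[p] x).coeff 0 ≠ 0 := minpoly.coeff_zero_ne_zero hint hx
  obtain ⟨n, hn⟩ := padic_norm_eq_rpow p _ h0
  have hdeg : 0 < (minpoly ℚ_[p] x).natDegree := minpoly.natDegree_pos hint
  refine ⟨(n : ℚ) / ((minpoly ℚ_[p] x).natDegree : ℚ), ?_⟩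
  rw [← PadicAlgCl.spectralNorm_eq, spectralNorm.spectralNorm_eq_norm_coeff_zero_rpow (K := ℚ_[p]) (L := PadicAlgCl p) x, hn,
    ← Real.rpow_mul (p_pos p).le]
  congr 1
  push_cast
  ring

open scoped Classical in
/-- The norm exponent: for `x ≠ 0`, a rational `q` with `‖x‖ = p^q` (a choice). [folklore] -/
def normExp (x : PadicAlgCl p) : ℚ := if hx : x = 0 then 0 else (exists_norm_eq_rpow_rat p x hx).choose

/-- `‖x‖ = p^{normExp x}` for `x ≠ 0`. [folklore] -/
theorem norm_eq_rpow_normExp {x : PadicAlgCl p} (hx : x ≠ 0) : ‖x‖ = (p : ℝ) ^ ((normExp p x : ℚ) : ℝ) := by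
  unfold normExp; rw [dif_neg hx]; exact (exists_norm_eq_rpow_rat p x hx).choose_spec

/-- `log ‖x‖ = normExp x · log p` for `x ≠ 0`. [folklore] -/
theorem log_norm {x : PadicAlgCl p} (hx : x ≠ 0) : Real.log ‖x‖ = (normExp p x : ℝ) * Real.log p := by
  rw [norm_eq_rpow_normExp p hx, Real.log_rpow (p_pos p)]

/-- `log ‖p‖ = −log p`. [folklore] -/
theorem log_norm_p : Real.log ‖(p : PadicAlgCl p)‖ = -Real.log p := by
  rw [norm_p, Real.log_inv]

/-- `log p > 0`. [folklore] -/
theorem log_p_pos : 0 < Real.log (p : ℝ) := Real.log_pos (one_lt_p p)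

/-- Rational powers of `p`: `p^q · p^{q'} = p^{q+q'}` bookkeeping in the form the model uses — any real power of a norm is again a
rational power of `p` when the exponent is rational. [folklore] -/
theorem norm_rpow_rat {x : PadicAlgCl p} (hx : x ≠ 0) (r : ℚ) : ‖x‖ ^ (r : ℝ) = (p : ℝ) ^ (((normExp p x * r : ℚ)) : ℝ) := by
  rw [norm_eq_rpow_normExp p hx, ← Real.rpow_mul (p_pos p).le]
  push_cast
  ring_nf

/-- Hence an element of norm `‖x‖^r` exists for every nonzero `x` and rational `r`. [folklore] -/
theorem exists_norm_eq_norm_rpow {x : PadicAlgCl p} (hx : x ≠ 0) (r : ℚ) :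
    ∃ c : PadicAlgCl p, c ≠ 0 ∧ ‖c‖ = ‖x‖ ^ (r : ℝ) := by
  obtain ⟨c, hc0, hc⟩ := exists_norm_eq_rpow p (normExp p x * r)
  exact ⟨c, hc0, by rw [hc, norm_rpow_rat p hx r]⟩

/-! ## (P) Powers of the norm as absolute values -/

/-- **(P)** For `e > 0`, `x ↦ ‖x‖^e` is an absolute value on `Q̄_p` (the triangle inequality from ultrametricity:
`‖x+y‖^e ≤ max(‖x‖,‖y‖)^e ≤ ‖x‖^e + ‖y‖^e`). [folklore] -/
def absPow (e : ℝ) (he : 0 < e) : AbsoluteValue (PadicAlgCl p) ℝ where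
  toFun x := ‖x‖ ^ e
  map_mul' x y := by simp only [norm_mul]; exact Real.mul_rpow (norm_nonneg _) (norm_nonneg _)
  nonneg' x := Real.rpow_nonneg (norm_nonneg _) _
  eq_zero' x := by
    rw [Real.rpow_eq_zero_iff_of_nonneg (norm_nonneg _), norm_eq_zero]
    exact ⟨fun h => h.1, fun h => ⟨h, he.ne'⟩⟩
  add_le' x y := by
    have h := PadicAlgCl.isNonarchimedean p x y
    have hx := Real.rpow_nonneg (norm_nonneg x) e
    have hy := Real.rpow_nonneg (norm_nonneg y) e
    calc ‖x + y‖ ^ e ≤ (max ‖x‖ ‖y‖) ^ e := Real.rpow_le_rpow (norm_nonneg _) h he.le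
      _ ≤ ‖x‖ ^ e + ‖y‖ ^ e := by
        rcases le_total ‖x‖ ‖y‖ with hxy | hxy
        · rw [max_eq_right hxy]; linarith
        · rw [max_eq_left hxy]; linarith

/-- `absPow e x = ‖x‖^e`. [folklore] -/
@[simp] theorem absPow_apply (e : ℝ) (he : 0 < e) (x : PadicAlgCl p) : absPow p e he x = ‖x‖ ^ e := rfl

/-- The standard norm as an absolute value (`e = 1`). [folklore] -/
def absOne : AbsoluteValue (PadicAlgCl p) ℝ := absPow p 1 one_pos

/-- `absOne x = ‖x‖`. [folklore] -/
@[simp] theorem absOne_apply (x : PadicAlgCl p) : absOne p x = ‖x‖ := by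
  simp [absOne, absPow_apply, Real.rpow_one]

end Summit.ABC.IUTFork.Joshi.Model

end
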